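import Literature.NumberTheory.QuadraticFields.ImaginaryQuadraticClassNumberValues
import Mathlib.NumberTheory.LegendreSymbol.JacobiSymbol
import Mathlib.Tactic.NormNum.Prime
import HarnessLib

set_option linter.dupNamespace false -- `Summit.BirchSwinnertonDyer.BirchSwinnertonDyer.Theorems.…` (summit = sub)
set_option autoImplicit false

/-!
# Crux `HeegnerTwistCouplingInSupply` (stmt-BirchSwinnertonDyer-21381) — KERNEL PARTNER TABLES below the analytic
# threshold: an explicit small prime `q ≡ 3 (mod 8)` of type `(3,+)` for every prime `p ≡ 3 (mod 4)`,
# `p ≡ ±2 (mod 5)`, `7 ≤ p < 800`, and of type `(3,−)` for every prime `p ≡ 3 (mod 8)`, `p ≡ ±1 (mod 5)`, `p < 200`,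
# each with `h(−5q) < p`

Route `BiquadraticEisensteinDescent` (cell `pub/bsd-wall`, row-12 line lead `bsd-line-ibd-p1` g11). Companion of
`…IndefinitePin.lean` (the indefinite pins `(3,+)` with `q ≤ 10p` for `p ≥ 800`, `(3,−)` with `q ≤ 4p` for `p ≥ 200`):
above those thresholds the Heegner field `K′ = ℚ(√−5q)` has `h(K′) < p` by the class number formula bound
(`h ≤ π⁻¹√|d| log|d|`, tree); below them this file supplies the partner prime by TABLE — the least prime `q ≡ 3 (mod 8)`
with the wanted Legendre type — and certifies `h(−5q) < p` by the tree's computable form class number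
`Quadratic.BinQF.classNumber` (Cox Thm. 2.13; field side `ClassNumberValues.classNumber_eq_of_discr_eq`). Only six partners
occur (`q ∈ {3, 11, 19, 43, 59, 83}`, `h(−5q) ∈ {2, 4, 8, 14, 8, 10}`), so every table row has `h(−5q) ≤ 14`.

Encoding: the Legendre type is read off residues mod `q` by brute force (`∀ x < q, x² ≢ p` resp. `∃ x < q, x² ≡ p`,
§1 bridges to `jacobiSym` via `ZMod.nonsquare_iff_jacobiSym_eq_neg_one` and reciprocity at two primes `≡ 3 (mod 4)`);
each table is ONE `decide +kernel` over `Finset.range` (residues first, primality of `p` next, then the search over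
the six partners; §2).
THEOREMS ONLY (the tables are the statements of §2, decided by the kernel); nothing about the crux, `L`-values or any
case of BSD is asserted. Supports stmt-BirchSwinnertonDyer-21381 (typed sub-corner rung, not the crux).
-/

namespace Summit.BirchSwinnertonDyer.BirchSwinnertonDyer.Theorems.BiquadraticEisensteinDescentHeegnerTwistCouplingInSupplyPartnerTables

open Literature.NumberTheory.QuadraticFields Literature.NumberTheory.QuadraticFields.Quadratic

/-! ## §1 Bridges: brute-force residues mod a prime `q` ⇒ Jacobi symbols -/

/-- A natural number `a` with `q ∤ a` that is NOT a square mod the prime `q` (checked over `x < q`) has `(a/q) = −1`.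
[folklore] -/
theorem jacobiSym_eq_neg_one_of_forall_sq_ne {a q : ℕ} (hq : q.Prime) (h : ∀ x < q, x * x % q ≠ a % q) :
    jacobiSym (a : ℤ) q = -1 := by
  haveI : Fact q.Prime := ⟨hq⟩
  rw [ZMod.nonsquare_iff_jacobiSym_eq_neg_one]
  rintro ⟨y, hy⟩
  refine h y.val (ZMod.val_lt y) ?_
  apply (ZMod.natCast_eq_natCast_iff' _ _ _).mp
  push_cast
  rw [ZMod.natCast_zmod_val, ← hy, Int.cast_natCast]

/-- A natural number `a` with `q ∤ a` that IS a square mod the prime `q` (a witness `x < q`) has `(a/q) = +1`.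
[folklore] -/
theorem jacobiSym_eq_one_of_exists_sq_eq {a q : ℕ} (hq : q.Prime) (hnd : a % q ≠ 0)
    (h : ∃ x < q, x * x % q = a % q) : jacobiSym (a : ℤ) q = 1 := by
  haveI : Fact q.Prime := ⟨hq⟩
  have hgcd : (a : ℤ).gcd q = 1 := by
    rw [Int.gcd_natCast_natCast]
    exact Nat.coprime_comm.mp ((Nat.Prime.coprime_iff_not_dvd hq).mpr fun hdvd => hnd (Nat.mod_eq_zero_of_dvd hdvd))
  rcases jacobiSym.eq_one_or_neg_one hgcd with h1 | h1
  · exact h1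
  · exfalso
    obtain ⟨x, -, hx⟩ := h
    refine ZMod.nonsquare_of_jacobiSym_eq_neg_one h1 ⟨(x : ZMod q), ?_⟩
    rw [Int.cast_natCast]
    have := (ZMod.natCast_eq_natCast_iff' (x * x) a q).mpr hx
    push_cast at this
    exact this.symm

/-- Type `(3,+)` from the table data: `p, q ≡ 3 (mod 4)` primes, `p` a non-residue mod `q` ⇒ `(q/p) = +1`
(reciprocity: `(q/p) = −(p/q)`). [folklore] -/
theorem jacobiSym_eq_one_of_table {p q : ℕ} (hq : q.Prime) (hp4 : p % 4 = 3) (hq8 : q % 8 = 3)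
    (h : ∀ x < q, x * x % q ≠ p % q) : jacobiSym (q : ℤ) p = 1 := by
  rw [jacobiSym.quadratic_reciprocity_three_mod_four (by omega) hp4, jacobiSym_eq_neg_one_of_forall_sq_ne hq h]
  norm_num

/-- Type `(3,−)` from the table data: `p, q ≡ 3 (mod 4)` primes, `q ∤ p`, `p` a residue mod `q` ⇒ `(q/p) = −1`.
[folklore] -/
theorem jacobiSym_eq_neg_one_of_table {p q : ℕ} (hq : q.Prime) (hp4 : p % 4 = 3) (hq8 : q % 8 = 3)
    (hnd : p % q ≠ 0) (h : ∃ x < q, x * x % q = p % q) : jacobiSym (q : ℤ) p = -1 := by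
  rw [jacobiSym.quadratic_reciprocity_three_mod_four (by omega) hp4, jacobiSym_eq_one_of_exists_sq_eq hq hnd h]

/-! ## §2 The tables (kernel) -/

/-- The six partner primes that occur, `3, 11, 19, 43, 59, 83`, are primes `≡ 3 (mod 8)`. [folklore] -/
theorem partnerPrimes_spec : ∀ q ∈ [3, 11, 19, 43, 59, 83], q.Prime ∧ q % 8 = 3 := by
  decide +kernel

/-- **Table `(3,+)` (kernel).** For every prime `p ≡ 3 (mod 4)`, `p ≡ ±2 (mod 5)`, `7 ≤ p < 800`: one of
`q ∈ {3, 11, 19, 43, 59, 83}` has `p` a NON-residue mod `q` and `h(−5q) < p` (form class number of discriminant `−5q`).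
The 35 rows `(p, q)`: `(7,11) (23,3) (43,11) (47,3) (67,19) (83,3) (103,19) (107,3) (127,11) (163,43) (167,3) (223,19)
(227,3) (263,3) (283,11) (307,11) (347,3) (367,59) (383,3) (443,3) (463,43) (467,3) (487,19) (503,3) (523,11) (547,11)
(563,3) (587,3) (607,11) (643,83) (647,3) (683,3) (727,43) (743,3) (787,11)`; primality of `p` is tested last-but-one.
[cite: Cox2013, §2.A Thm. 2.13] -/
theorem tablePlus : ∀ p ∈ Finset.range 800, p % 4 = 3 → (p % 5 = 2 ∨ p % 5 = 3) → 7 ≤ p → p.Prime →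
    ∃ q ∈ [3, 11, 19, 43, 59, 83], (∀ x < q, x * x % q ≠ p % q) ∧ BinQF.classNumber (-((5 * q : ℕ) : ℤ)) < p := by
  decide +kernel

/-- **Table `(3,−)` (kernel).** For every prime `p ≡ 3 (mod 8)`, `p ≡ ±1 (mod 5)`, `p < 200`: one of
`q ∈ {3, 11, 19, 43, 59, 83}` has `q ∤ p`, `p` a residue mod `q`, and `h(−5q) < p`. Rows `(p, q)`:
`(11,19) (19,3) (59,11) (131,19) (139,3) (179,11)`. [cite: Cox2013, §2.A Thm. 2.13] -/
theorem tableMinus : ∀ p ∈ Finset.range 200, p % 8 = 3 → (p % 5 = 1 ∨ p % 5 = 4) → p.Prime →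
    ∃ q ∈ [3, 11, 19, 43, 59, 83], p % q ≠ 0 ∧ (∃ x < q, x * x % q = p % q) ∧
      BinQF.classNumber (-((5 * q : ℕ) : ℤ)) < p := by
  decide +kernel

/-! ## §3 The partner primes below the thresholds -/

/-- **Partner of type `(3,+)` below `800`.** For every prime `p ≡ 3 (mod 4)`, `p ≡ ±2 (mod 5)`, `7 ≤ p < 800` there is a
prime `q ≡ 3 (mod 8)` with `(q/p) = +1` and `h(−5q) < p` (form class number of discriminant `−5q`).
[cite: Cox2013, §2.A Thm. 2.13] -/
theorem exists_partner_threePlus_of_lt {p : ℕ} (hp : p.Prime) (hp4 : p % 4 = 3) (hp5 : p % 5 = 2 ∨ p % 5 = 3)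
    (h7 : 7 ≤ p) (h800 : p < 800) :
    ∃ q : ℕ, q.Prime ∧ q % 8 = 3 ∧ jacobiSym (q : ℤ) p = 1 ∧ BinQF.classNumber (-((5 * q : ℕ) : ℤ)) < p := by
  obtain ⟨q, hq, hres, hh⟩ := tablePlus p (Finset.mem_range.mpr h800) hp4 hp5 h7 hp
  obtain ⟨hqP, hq8⟩ := partnerPrimes_spec q hq
  exact ⟨q, hqP, hq8, jacobiSym_eq_one_of_table hqP hp4 hq8 hres, hh⟩

/-- **Partner of type `(3,−)` below `200`.** For every prime `p ≡ 3 (mod 8)`, `p ≡ ±1 (mod 5)`, `p < 200` there is a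
prime `q ≡ 3 (mod 8)` with `(q/p) = −1` and `h(−5q) < p`. [cite: Cox2013, §2.A Thm. 2.13] -/
theorem exists_partner_threeMinus_of_lt {p : ℕ} (hp : p.Prime) (hp8 : p % 8 = 3) (hp5 : p % 5 = 1 ∨ p % 5 = 4)
    (h200 : p < 200) :
    ∃ q : ℕ, q.Prime ∧ q % 8 = 3 ∧ jacobiSym (q : ℤ) p = -1 ∧ BinQF.classNumber (-((5 * q : ℕ) : ℤ)) < p := by
  obtain ⟨q, hq, hnd, hres, hh⟩ := tableMinus p (Finset.mem_range.mpr h200) hp8 hp5 hp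
  obtain ⟨hqP, hq8⟩ := partnerPrimes_spec q hq
  exact ⟨q, hqP, hq8, jacobiSym_eq_neg_one_of_table hqP (by omega) hq8 hnd hres, hh⟩

end Summit.BirchSwinnertonDyer.BirchSwinnertonDyer.Theorems.BiquadraticEisensteinDescentHeegnerTwistCouplingInSupplyPartnerTables
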